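import Summits.FinalStateConjecture.FinalStateConjecture.Theorems.StarvedNecksNeckGapDecayTwistMap
import Mathlib.Analysis.SpecialFunctions.SmoothTransition
import HarnessLib

/-!
# The twist angle field of the twisted Schwarzschild input (crux `StarvedNecks.NeckGapDecay`,
# stmt-FinalStateConjecture-16768, line `Sketch`; model check of the physics stub's hypothesis)

The angle field `β(x) = c · S(‖x⃗‖² / λ(x⁰)²)` used to twist the exact Schwarzschild hole chart:
`S` a smooth step (`0` below `1`, `1` above `2`; Mathlib's `Real.smoothTransition` shifted), `λ(t) =
b + ¼ log(1 + t²)` a slow receding profile (`|λ'| ≤ ¼`, `λ → ∞`).  So `β = 0` on the INNER region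
`{‖x⃗‖ < λ(x⁰)}` (the twist is the identity there: fixed-radius convergence of the twisted chart will
be EXACT), `β = c` beyond `‖x⃗‖ ≥ √2 λ(x⁰)` (a constant rotation: an isometry), and on the shell the
lever-arm-weighted gradient obeys `‖dβ(x)‖ · ‖x⃗‖ ≤ 6 c C_S` with `C_S` a bound of `|S'|` — the `C⁰`
honesty budget of the crux's `HonestFar`(3).  References: O'Neill 1995, Ch. 2, §2.2; DHRT arXiv:2104.08222,
§1.  Summit-side auxiliaries only (`stepS`, `lam`, `qsq`, `ratio`, `angle`, `pt`).
-/

noncomputable section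

open Set Function Filter Topology
open scoped Topology ContDiff

namespace Summit.FinalStateConjecture.FinalStateConjecture.Theorems.NeckGapDecay.ConnectionLevelCones.Twist

open Literature.Geometry.Lorentzian

-- the problem namespace `Summit.FinalStateConjecture.FinalStateConjecture` repeats the summit name by design
set_option linter.dupNamespace false

/-! ## The smooth step -/

/-- The smooth step `S(u) = smoothTransition(u − 1)`: `0` for `u ≤ 1`, `1` for `u ≥ 2`, smooth. [folklore] -/
def stepS (u : ℝ) : ℝ := Real.smoothTransition (u - 1)

/-- `S = 0` below `1`. [folklore] -/
theorem stepS_of_le_one {u : ℝ} (h : u ≤ 1) : stepS u = 0 :=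
  Real.smoothTransition.zero_of_nonpos (by linarith)

/-- `S = 1` above `2`. [folklore] -/
theorem stepS_of_two_le {u : ℝ} (h : 2 ≤ u) : stepS u = 1 :=
  Real.smoothTransition.one_of_one_le (by linarith)

/-- `S` is smooth. [folklore] -/
theorem contDiff_stepS {n : ℕ∞} : ContDiff ℝ n stepS :=
  Real.smoothTransition.contDiff.comp (contDiff_id.sub contDiff_const)

/-- `S` is differentiable. [folklore] -/
theorem differentiable_stepS : Differentiable ℝ stepS :=
  (contDiff_stepS (n := 1)).differentiable (by simp)

/-- `S` is continuous. [folklore] -/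
theorem continuous_stepS : Continuous stepS := differentiable_stepS.continuous

/-- `S'` is continuous. [folklore] -/
theorem continuous_deriv_stepS : Continuous (deriv stepS) :=
  (contDiff_stepS (n := 1)).continuous_deriv le_rfl

/-- `S' = 0` below `1` (locally constant). [folklore] -/
theorem deriv_stepS_of_lt_one {u : ℝ} (h : u < 1) : deriv stepS u = 0 := by
  have hev : stepS =ᶠ[𝓝 u] fun _ ↦ (0 : ℝ) := by
    filter_upwards [Iio_mem_nhds h] with v hv using stepS_of_le_one hv.le
  rw [hev.deriv_eq]; exact deriv_const u 0

/-- `S' = 0` above `2` (locally constant). [folklore] -/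
theorem deriv_stepS_of_two_lt {u : ℝ} (h : 2 < u) : deriv stepS u = 0 := by
  have hev : stepS =ᶠ[𝓝 u] fun _ ↦ (1 : ℝ) := by
    filter_upwards [Ioi_mem_nhds h] with v hv using stepS_of_two_le hv.le
  rw [hev.deriv_eq]; exact deriv_const u 1

/-- **A global bound of `S'`**: continuous on the compact `[1, 2]`, zero outside. [folklore] -/
theorem exists_bound_deriv_stepS : ∃ C : ℝ, 0 ≤ C ∧ ∀ u, |deriv stepS u| ≤ C := by
  obtain ⟨C, hC⟩ := isCompact_Icc.exists_bound_of_continuousOn (s := Icc (1 : ℝ) 2)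
    continuous_deriv_stepS.continuousOn
  refine ⟨max C 0, le_max_right _ _, fun u ↦ ?_⟩
  rcases lt_or_ge u 1 with h1 | h1
  · rw [deriv_stepS_of_lt_one h1, abs_zero]; exact le_max_right _ _
  rcases le_or_gt u 2 with h2 | h2
  · have := hC u ⟨h1, h2⟩
    rw [Real.norm_eq_abs] at this
    exact this.trans (le_max_left _ _)
  · rw [deriv_stepS_of_two_lt h2, abs_zero]; exact le_max_right _ _

/-- A bound `C_S ≥ 0` of `|S'|`. [folklore] -/
def C_S : ℝ := Classical.choose exists_bound_deriv_stepS

/-- `C_S ≥ 0`. [folklore] -/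
theorem C_S_nonneg : 0 ≤ C_S := (Classical.choose_spec exists_bound_deriv_stepS).1

/-- `|S'| ≤ C_S` everywhere. [folklore] -/
theorem abs_deriv_stepS_le (u : ℝ) : |deriv stepS u| ≤ C_S :=
  (Classical.choose_spec exists_bound_deriv_stepS).2 u

/-! ## The slow receding profile `λ(t) = b + ¼ log(1 + t²)` -/

/-- The profile `λ(t) = b + ¼ log(1 + t²)`. [folklore] -/
def lam (b : ℝ) (t : ℝ) : ℝ := b + 1 / 4 * Real.log (1 + t ^ 2)

/-- `λ ≥ b`. [folklore] -/
theorem le_lam (b t : ℝ) : b ≤ lam b t := by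
  have : 0 ≤ Real.log (1 + t ^ 2) := Real.log_nonneg (by nlinarith [sq_nonneg t])
  unfold lam; linarith

/-- `λ` is continuous. [folklore] -/
theorem continuous_lam (b : ℝ) : Continuous (lam b) :=
  continuous_const.add (continuous_const.mul ((continuous_const.add (continuous_pow 2)).log
    fun t ↦ (add_pos_of_pos_of_nonneg one_pos (sq_nonneg t)).ne'))

/-- `λ` is smooth. [folklore] -/
theorem contDiff_lam (b : ℝ) {n : WithTop ℕ∞} : ContDiff ℝ n (lam b) :=
  contDiff_const.add (contDiff_const.mul ((contDiff_const.add (contDiff_id.pow 2)).log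
    fun t ↦ (add_pos_of_pos_of_nonneg one_pos (sq_nonneg t)).ne'))

/-- `λ' = t / (2 (1 + t²))`. [folklore] -/
theorem hasDerivAt_lam (b t : ℝ) : HasDerivAt (lam b) (t / (2 * (1 + t ^ 2))) t := by
  have h1 : HasDerivAt (fun t : ℝ ↦ 1 + t ^ 2) (2 * t) t := by
    simpa using (hasDerivAt_pow 2 t).const_add 1
  have h2 : HasDerivAt (fun t : ℝ ↦ Real.log (1 + t ^ 2)) ((2 * t) / (1 + t ^ 2)) t :=
    h1.log (by positivity)
  have h3 : HasDerivAt (lam b) (1 / 4 * (2 * t / (1 + t ^ 2))) t := (h2.const_mul (1 / 4 : ℝ)).const_add b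
  refine h3.congr_deriv ?_
  field_simp
  ring

/-- `|λ'| ≤ ¼` (`2|t| ≤ 1 + t²`). [folklore] -/
theorem abs_deriv_lam_le (t : ℝ) : |t / (2 * (1 + t ^ 2))| ≤ 1 / 4 := by
  rw [abs_div, abs_of_pos (by positivity : (0 : ℝ) < 2 * (1 + t ^ 2)), div_le_iff₀ (by positivity)]
  nlinarith [abs_nonneg t, sq_abs t, sq_nonneg (|t| - 1)]

/-- `λ → ∞`. [folklore] -/
theorem tendsto_lam_atTop (b : ℝ) : Tendsto (lam b) atTop atTop := by
  have h1 : Tendsto (fun t : ℝ ↦ 1 + t ^ 2) atTop atTop :=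
    tendsto_atTop_add_const_left _ _ (tendsto_pow_atTop two_ne_zero)
  have h2 : Tendsto (fun t : ℝ ↦ Real.log (1 + t ^ 2)) atTop atTop := Real.tendsto_log_atTop.comp h1
  exact tendsto_atTop_add_const_left _ _ (h2.const_mul_atTop (by norm_num))

/-! ## The squared spatial radius and the shell ratio -/

/-- `q(x) = x₁² + x₂² + x₃² = ‖x⃗‖²`. [folklore] -/
def qsq (x : E4) : ℝ := x 1 ^ 2 + x 2 ^ 2 + x 3 ^ 2

/-- `q = ‖x⃗‖²`. [folklore] -/
theorem qsq_eq (x : E4) : qsq x = E4.spatialNorm x ^ 2 := (E4.spatialNorm_sq x).symm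

/-- `q ≥ 0`. [folklore] -/
theorem qsq_nonneg (x : E4) : 0 ≤ qsq x := by rw [qsq_eq]; positivity

/-- `q` is axially invariant. [folklore] -/
theorem qsq_axialRotation (α : ℝ) (x : E4) : qsq (E4.axialRotation α x) = qsq x := by
  rw [qsq_eq, qsq_eq, E4.spatialNorm_axialRotation]

/-- The coordinate derivative covectors. [folklore] -/
abbrev dxp (j : Fin 4) : E4 →L[ℝ] ℝ := PiLp.proj (𝕜 := ℝ) 2 (fun _ : Fin 4 ↦ ℝ) j

/-- `dq = 2 x₁ dx₁ + 2 x₂ dx₂ + 2 x₃ dx₃`. [folklore] -/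
theorem hasFDerivAt_qsq (x : E4) :
    HasFDerivAt qsq ((2 * x 1) • dxp 1 + (2 * x 2) • dxp 2 + (2 * x 3) • dxp 3) x := by
  have hp : ∀ j : Fin 4, HasFDerivAt (fun y : E4 ↦ y j) (dxp j) x := fun j ↦ (dxp j).hasFDerivAt
  have h := (((hp 1).pow 2).add ((hp 2).pow 2)).add ((hp 3).pow 2)
  refine (h.congr_fderiv ?_)
  ext v
  simp

/-- `|vᵢ| ≤ ‖v‖` on `E4`. [folklore] -/
theorem abs_apply_le_norm (v : E4) (i : Fin 4) : |v i| ≤ ‖v‖ := by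
  have h : ‖v‖ ^ 2 = v 0 ^ 2 + v 1 ^ 2 + v 2 ^ 2 + v 3 ^ 2 := by
    rw [EuclideanSpace.real_norm_sq_eq, Fin.sum_univ_four]
  have hi : v i ^ 2 ≤ ‖v‖ ^ 2 := by
    rw [h]
    fin_cases i <;> simp <;> nlinarith [sq_nonneg (v 0), sq_nonneg (v 1), sq_nonneg (v 2), sq_nonneg (v 3)]
  exact abs_le_of_sq_le_sq' hi (norm_nonneg v) |> fun h' ↦ abs_le.mpr h'

/-- `|dq(v)| ≤ 2 ‖x⃗‖ ‖v‖` (Cauchy–Schwarz on the spatial part). [folklore] -/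
theorem norm_fderiv_qsq_le (x : E4) : ‖fderiv ℝ qsq x‖ ≤ 2 * E4.spatialNorm x := by
  rw [(hasFDerivAt_qsq x).fderiv]
  refine ContinuousLinearMap.opNorm_le_bound _ (mul_nonneg zero_le_two (E4.spatialNorm_nonneg x)) fun v ↦ ?_
  have hs : E4.spatialNorm x ^ 2 = x 1 ^ 2 + x 2 ^ 2 + x 3 ^ 2 := E4.spatialNorm_sq x
  have hv : ‖v‖ ^ 2 = v 0 ^ 2 + v 1 ^ 2 + v 2 ^ 2 + v 3 ^ 2 := by
    rw [EuclideanSpace.real_norm_sq_eq, Fin.sum_univ_four]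
  have hval : ((2 * x 1) • dxp 1 + (2 * x 2) • dxp 2 + (2 * x 3) • dxp 3) v =
      2 * (x 1 * v 1 + x 2 * v 2 + x 3 * v 3) := by
    simp; ring
  rw [hval, Real.norm_eq_abs, abs_mul, abs_two]
  have hcs : |x 1 * v 1 + x 2 * v 2 + x 3 * v 3| ≤ E4.spatialNorm x * ‖v‖ := by
    rw [abs_le]
    constructor <;>
      nlinarith [E4.spatialNorm_nonneg x, norm_nonneg v, sq_nonneg (v 0),
        sq_nonneg (x 1 * v 2 - x 2 * v 1), sq_nonneg (x 1 * v 3 - x 3 * v 1), sq_nonneg (x 2 * v 3 - x 3 * v 2),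
        sq_nonneg (x 1 * ‖v‖ - E4.spatialNorm x * v 1), sq_nonneg (x 1 * ‖v‖ + E4.spatialNorm x * v 1),
        mul_nonneg (E4.spatialNorm_nonneg x) (norm_nonneg v)]
  nlinarith

/-- The shell ratio `g(x) = q(x) / λ(x⁰)²`. [folklore] -/
def ratio (b : ℝ) (x : E4) : ℝ := qsq x / lam b (x 0) ^ 2

/-- The ratio is axially invariant. [folklore] -/
theorem ratio_axialRotation (b α : ℝ) (x : E4) : ratio b (E4.axialRotation α x) = ratio b x := by
  rw [ratio, ratio, qsq_axialRotation, E4.axialRotation_apply_zero]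

variable {b : ℝ}

/-- `λ(x⁰) > 0` when `b > 0`. [folklore] -/
theorem lam_pos (hb : 0 < b) (t : ℝ) : 0 < lam b t := hb.trans_le (le_lam b t)

/-- The ratio is smooth (`b > 0`). [folklore] -/
theorem contDiff_ratio (hb : 0 < b) {n : WithTop ℕ∞} : ContDiff ℝ n (ratio b) := by
  have hq : ContDiff ℝ n qsq := by
    have hp : ∀ j : Fin 4, ContDiff ℝ n fun y : E4 ↦ y j := fun j ↦ (dxp j).contDiff
    exact (((hp 1).pow 2).add ((hp 2).pow 2)).add ((hp 3).pow 2)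
  have hl : ContDiff ℝ n fun x : E4 ↦ lam b (x 0) ^ 2 := ((contDiff_lam b).comp (dxp 0).contDiff).pow 2
  exact hq.div hl fun x ↦ (pow_pos (lam_pos hb _) 2).ne'

/-- **The ratio's derivative with its lever arm is bounded on the shell**: for `b ≥ 1` and
`q(x) ≤ 2 λ(x⁰)²`, `‖dg(x)‖ · ‖x⃗‖ ≤ 6` (`dg = dq/λ² − 2 q λ'/λ³ dx⁰`, `|dq| ≤ 2s`, `|λ'| ≤ ¼`). [folklore] -/
theorem norm_fderiv_ratio_mul_le (hb : 1 ≤ b) {x : E4} (hx : qsq x ≤ 2 * lam b (x 0) ^ 2) :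
    ‖fderiv ℝ (ratio b) x‖ * E4.spatialNorm x ≤ 6 := by
  have hb0 : 0 < b := by linarith
  set L := lam b (x 0) with hL
  have hL1 : 1 ≤ L := hb.trans (le_lam b _)
  have hL0 : 0 < L := by linarith
  set s := E4.spatialNorm x with hs
  have hs0 : 0 ≤ s := E4.spatialNorm_nonneg x
  have hq : qsq x = s ^ 2 := qsq_eq x
  -- `s ≤ √2 L ≤ 3/2 L`
  have hsL : s ≤ 3 / 2 * L := by nlinarith
  -- the derivative of `x ↦ (λ(x⁰)²)⁻¹`
  have hlam : HasDerivAt (lam b) (x 0 / (2 * (1 + x 0 ^ 2))) (x 0) := hasDerivAt_lam b (x 0)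
  set l' : ℝ := x 0 / (2 * (1 + x 0 ^ 2)) with hl'
  have hl'4 : |l'| ≤ 1 / 4 := abs_deriv_lam_le (x 0)
  have hW : HasDerivAt (fun t ↦ (lam b t ^ 2)⁻¹) (-(2 * L * l') / (L ^ 2) ^ 2) (x 0) := by
    have h1 : HasDerivAt (fun t ↦ lam b t ^ 2) (2 * L * l') (x 0) :=
      (hlam.pow 2).congr_deriv (by rw [hL]; norm_num)
    exact h1.inv (pow_pos hL0 2).ne'
  have h0 : HasFDerivAt (fun y : E4 ↦ y 0) (dxp 0) x := (dxp 0).hasFDerivAt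
  have hW' : HasFDerivAt ((fun t ↦ (lam b t ^ 2)⁻¹) ∘ fun y : E4 ↦ y 0) ((-(2 * L * l') / (L ^ 2) ^ 2) • dxp 0) x :=
    hW.comp_hasFDerivAt x h0
  have hq' := hasFDerivAt_qsq x
  have hprod : HasFDerivAt (ratio b)
      (qsq x • ((-(2 * L * l') / (L ^ 2) ^ 2) • dxp 0) +
        (lam b (x 0) ^ 2)⁻¹ • ((2 * x 1) • dxp 1 + (2 * x 2) • dxp 2 + (2 * x 3) • dxp 3)) x := by
    have h := hq'.mul hW'
    refine h.congr_of_eventuallyEq (Eventually.of_forall fun y ↦ ?_)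
    simp [ratio, div_eq_mul_inv, Function.comp]
  rw [hprod.fderiv]
  have hn1 : ‖qsq x • ((-(2 * L * l') / (L ^ 2) ^ 2) • dxp 0)‖ ≤ s ^ 2 * (1 / (2 * L ^ 3)) := by
    rw [norm_smul, norm_smul, Real.norm_eq_abs, Real.norm_eq_abs, hq, abs_of_nonneg (sq_nonneg s)]
    have hdx : ‖dxp 0‖ ≤ 1 := by
      refine ContinuousLinearMap.opNorm_le_bound _ zero_le_one fun v ↦ ?_
      rw [one_mul]
      exact abs_apply_le_norm v 0
    have hcoef : |-(2 * L * l') / (L ^ 2) ^ 2| ≤ 1 / (2 * L ^ 3) := by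
      rw [abs_div, abs_neg, abs_of_pos (by positivity : (0 : ℝ) < (L ^ 2) ^ 2), abs_mul,
        abs_of_pos (by positivity : (0 : ℝ) < 2 * L), div_le_div_iff₀ (by positivity) (by positivity)]
      nlinarith [mul_nonneg (by positivity : (0 : ℝ) ≤ L ^ 4) (abs_nonneg l')]
    calc s ^ 2 * (|-(2 * L * l') / (L ^ 2) ^ 2| * ‖dxp 0‖) ≤ s ^ 2 * (1 / (2 * L ^ 3) * 1) := by
          gcongr
      _ = s ^ 2 * (1 / (2 * L ^ 3)) := by ring
  have hn2 : ‖(lam b (x 0) ^ 2)⁻¹ • ((2 * x 1) • dxp 1 + (2 * x 2) • dxp 2 + (2 * x 3) • dxp 3)‖ ≤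
      (L ^ 2)⁻¹ * (2 * s) := by
    rw [norm_smul, Real.norm_eq_abs, abs_of_pos (by positivity), ← (hasFDerivAt_qsq x).fderiv]
    exact mul_le_mul_of_nonneg_left (norm_fderiv_qsq_le x) (by positivity)
  have hsum := (norm_add_le _ _).trans (add_le_add hn1 hn2)
  calc _ ≤ (s ^ 2 * (1 / (2 * L ^ 3)) + (L ^ 2)⁻¹ * (2 * s)) * s := mul_le_mul_of_nonneg_right hsum hs0
    _ = (s ^ 3 / L ^ 3) / 2 + 2 * (s ^ 2 / L ^ 2) := by field_simp
    _ ≤ (27 / 8) / 2 + 2 * 2 := by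
        have h1 : s ^ 3 / L ^ 3 ≤ 27 / 8 := by
          rw [div_le_iff₀ (by positivity)]; nlinarith [pow_le_pow_left₀ hs0 hsL 3]
        have h2 : s ^ 2 / L ^ 2 ≤ 2 := by
          rw [div_le_iff₀ (by positivity)]; nlinarith
        linarith
    _ ≤ 6 := by norm_num

/-! ## The angle field -/

/-- **The twist angle field** `β(x) = c · S(q(x) / λ(x⁰)²)`. [folklore] -/
def angle (c b : ℝ) (x : E4) : ℝ := c * stepS (ratio b x)

variable {c : ℝ}

/-- The angle field is axially invariant. [folklore] -/
theorem isAxial_angle (c b : ℝ) : IsAxial (angle c b) := fun α x ↦ by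
  rw [angle, angle, ratio_axialRotation]

/-- The angle field is smooth (`b > 0`). [folklore] -/
theorem contDiff_angle (c : ℝ) (hb : 0 < b) {n : ℕ∞} : ContDiff ℝ n (angle c b) :=
  contDiff_const.mul (contDiff_stepS.comp (contDiff_ratio hb))

/-- The angle field is continuous (`b > 0`). [folklore] -/
theorem continuous_angle (c : ℝ) (hb : 0 < b) : Continuous (angle c b) :=
  (contDiff_angle c hb (n := 0)).continuous

/-- The angle VANISHES on the inner region `q ≤ λ(x⁰)²`. [folklore] -/
theorem angle_eq_zero (c : ℝ) (hb : 0 < b) {x : E4} (hx : qsq x ≤ lam b (x 0) ^ 2) : angle c b x = 0 := by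
  have h : ratio b x ≤ 1 := by
    rw [ratio, div_le_one (pow_pos (lam_pos hb _) 2)]; exact hx
  rw [angle, stepS_of_le_one h, mul_zero]

/-- The angle is the CONSTANT `c` beyond `q ≥ 2 λ(x⁰)²`. [folklore] -/
theorem angle_eq_const (c : ℝ) (hb : 0 < b) {x : E4} (hx : 2 * lam b (x 0) ^ 2 ≤ qsq x) : angle c b x = c := by
  have h : 2 ≤ ratio b x := by
    rw [ratio, le_div_iff₀ (pow_pos (lam_pos hb _) 2)]; exact hx
  rw [angle, stepS_of_two_le h, mul_one]

/-- **The derivative of the angle field** (chain rule): `dβ(x) = c S'(g(x)) dg(x)`. [folklore] -/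
theorem hasFDerivAt_angle (c : ℝ) (hb : 0 < b) (x : E4) :
    HasFDerivAt (angle c b) ((c * deriv stepS (ratio b x)) • fderiv ℝ (ratio b) x) x := by
  have hr : HasFDerivAt (ratio b) (fderiv ℝ (ratio b) x) x :=
    ((contDiff_ratio hb (n := 1)).differentiable (by simp) x).hasFDerivAt
  have hS : HasDerivAt stepS (deriv stepS (ratio b x)) (ratio b x) := (differentiable_stepS _).hasDerivAt
  have h := (hS.comp_hasFDerivAt x hr).const_mul c
  rw [mul_smul]
  exact h

/-- **The lever-arm-weighted gradient bound**: `‖dβ(x)‖ · ‖x⃗‖ ≤ 6 |c| C_S` everywhere (`b ≥ 1`):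
on the shell by `norm_fderiv_ratio_mul_le` and `|S'| ≤ C_S`, beyond it because `S' = 0`. [folklore] -/
theorem norm_fderiv_angle_mul_le (c : ℝ) (hb : 1 ≤ b) (x : E4) :
    ‖fderiv ℝ (angle c b) x‖ * E4.spatialNorm x ≤ 6 * |c| * C_S := by
  have hb0 : 0 < b := by linarith
  rw [(hasFDerivAt_angle c hb0 x).fderiv, norm_smul, Real.norm_eq_abs, abs_mul]
  rcases le_or_gt (qsq x) (2 * lam b (x 0) ^ 2) with hx | hx
  · have h1 := norm_fderiv_ratio_mul_le hb hx
    have h2 := abs_deriv_stepS_le (ratio b x)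
    calc |c| * |deriv stepS (ratio b x)| * ‖fderiv ℝ (ratio b) x‖ * E4.spatialNorm x
        = |c| * |deriv stepS (ratio b x)| * (‖fderiv ℝ (ratio b) x‖ * E4.spatialNorm x) := by ring
      _ ≤ |c| * C_S * 6 :=
          mul_le_mul (mul_le_mul_of_nonneg_left h2 (abs_nonneg c)) h1
            (mul_nonneg (norm_nonneg _) (E4.spatialNorm_nonneg _)) (mul_nonneg (abs_nonneg _) C_S_nonneg)
      _ = 6 * |c| * C_S := by ring
  · have h : 2 < ratio b x := by
      rw [ratio, lt_div_iff₀ (pow_pos (lam_pos hb0 _) 2)]; exact hx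
    rw [deriv_stepS_of_two_lt h, abs_zero, mul_zero, zero_mul, zero_mul]
    exact mul_nonneg (mul_nonneg (by norm_num) (abs_nonneg c)) C_S_nonneg

/-- The inner region `{q < λ(x⁰)²}` is open. [folklore] -/
theorem isOpen_inner (b : ℝ) : IsOpen {x : E4 | qsq x < lam b (x 0) ^ 2} := by
  have hq : Continuous qsq := by
    have hp : ∀ j : Fin 4, Continuous fun y : E4 ↦ y j := fun j ↦ (dxp j).continuous
    exact (((hp 1).pow 2).add ((hp 2).pow 2)).add ((hp 3).pow 2)
  exact isOpen_lt hq (((continuous_lam b).comp (dxp 0).continuous).pow 2)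

/-! ## The radial test line `u ↦ (τ, u, 0, 0)` -/

/-- The point `(τ, u, 0, 0)`. [folklore] -/
def pt (τ u : ℝ) : E4 := WithLp.toLp 2 ![τ, u, 0, 0]

/-- Time component of the test point. [folklore] -/
@[simp] theorem pt_apply_zero (τ u : ℝ) : pt τ u 0 = τ := rfl
/-- First component of the test point. [folklore] -/
@[simp] theorem pt_apply_one (τ u : ℝ) : pt τ u 1 = u := rfl
/-- Second component of the test point. [folklore] -/
@[simp] theorem pt_apply_two (τ u : ℝ) : pt τ u 2 = 0 := rfl
/-- Third component of the test point. [folklore] -/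
@[simp] theorem pt_apply_three (τ u : ℝ) : pt τ u 3 = 0 := rfl

/-- `q(τ, u, 0, 0) = u²`. [folklore] -/
@[simp] theorem qsq_pt (τ u : ℝ) : qsq (pt τ u) = u ^ 2 := by simp [qsq]

/-- `‖(τ, u, 0, 0)⃗‖ = |u|`. [folklore] -/
theorem spatialNorm_pt (τ u : ℝ) : E4.spatialNorm (pt τ u) = |u| := by
  have h : E4.spatialNorm (pt τ u) ^ 2 = |u| ^ 2 := by rw [← qsq_eq, qsq_pt, sq_abs]
  nlinarith [E4.spatialNorm_nonneg (pt τ u), abs_nonneg u, h]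

/-- The line is affine in `u`: `(τ, u, 0, 0) = (τ, 0, 0, 0) + u e₁`. [folklore] -/
theorem pt_eq (τ u : ℝ) : pt τ u = pt τ 0 + u • E4.basisVector 1 := by
  ext i; fin_cases i <;> simp [pt]

/-- The line has velocity `e₁`. [folklore] -/
theorem hasDerivAt_pt (τ u : ℝ) : HasDerivAt (pt τ) (E4.basisVector 1) u := by
  have h : HasDerivAt (fun u : ℝ ↦ pt τ 0 + u • E4.basisVector 1) (E4.basisVector 1) u := by
    simpa using ((hasDerivAt_id u).smul_const (E4.basisVector 1)).const_add (pt τ 0)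
  refine h.congr_of_eventuallyEq (Eventually.of_forall fun v ↦ ?_)
  exact pt_eq τ v

/-- `J (τ, u, 0, 0) = u e₂`. [folklore] -/
theorem axialGenerator_pt (τ u : ℝ) : E4.axialGenerator (pt τ u) = u • E4.basisVector 2 := by
  ext i; fin_cases i <;> simp [pt]

/-- The angle along the line: `β(τ, u, 0, 0) = c S(u² / λ(τ)²)`. [folklore] -/
theorem angle_pt (c b τ u : ℝ) : angle c b (pt τ u) = c * stepS (u ^ 2 / lam b τ ^ 2) := by
  simp [angle, ratio]

end Summit.FinalStateConjecture.FinalStateConjecture.Theorems.NeckGapDecay.ConnectionLevelCones.Twist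

end
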